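import Literature.Geometry.Symplectic.ZeroCircleZerosOnAxis
import Literature.Geometry.Symplectic.NearSymplecticAdaptedFrame
import Literature.Geometry.Symplectic.SelfDualTripleRotation
import Literature.Geometry.Symplectic.HondaModelChartAxis
import Literature.Geometry.Kaehler.ManifoldFormsPullback
import Literature.Topology.FourManifolds.FrameCoefficientsContinuous
import Mathlib.Topology.Order.IntermediateValue
import HarnessLib

/-!
# The gradient family of a near-symplectic form along a zero circle, in a tubular chart

Topic `Geometry/Symplectic`; namespace `Literature.Geometry.Symplectic`.  Theorems only; no named
fact, no `sorry`.  Let `sf` be a smooth closed `2`-form on a `4`-manifold with positive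
(= definite transverse) zeros along a `2π`-periodic curve `γ`, and `χ : ℝ⁴ → M` a `2π`-periodic
tubular chart about `γ` (smooth immersion of the model tube, `χ(θ e₀) = γ(θ)`, differential along
the axis given by a continuous periodic frame `ν`).  Writing `J(θ)` for the gradient of the
pulled-back form `χ^* sf` at the axis point `θ e₀` (a linear map `ℝ⁴ →L Λ²(ℝ⁴)*`), this file
verifies the hypotheses of the block-frame theorem `exists_contDiff_blockFrame`:

* `contDiff_zeroGradient_pullback_axis` — `θ ↦ J(θ) W` is `C^∞` (the pull-back is `C^∞` on the
  open tube, `ZeroCircleZerosOnAxis.contDiffAt_pullback_of_mem_hondaTube`);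
* `zeroGradient_pullback_axis_periodic` — `J(θ + 2π) = J(θ)`;
* `zeroGradient_pullback_axis_stdVec_zero` — `J(θ) e₀ = 0` (the form vanishes along the axis);
* `zeroGradient_pullback_axis_symm` — Perutz's form `J(θ)(p)(e₀, q)` is symmetric (closedness,
  naturality of `d`, `zeroNormalForm_symm`);
* `finrank_range_zeroGradient_pullback_axis`, `exists_sign_zeroGradient_pullback_axis` — rank `3`
  and a CONSTANT definite sign `s = ±1` of the image (transport of positive zeros,
  `NearSymplecticPullbackTransport`, and connectedness of `ℝ`);
* `exists_continuous_minority_seed` — a continuous `2π`-periodic family of minority vectors of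
  Perutz's form from the even-circle section `V` (coefficients in the frame `ν`,
  `continuous_frameCoefficients`).

This is the passage "(t, x₁, x₂, x₃) near Z … ω(t, x) = x · S(t) β + O(|x|²)" of Perutz 2006, §3
(proof of Lemma 3.1, step 1), prepared metric-free.

## References

* T. Perutz, *Zero-sets of near-symplectic forms*, J. Symplectic Geom. 4 (2006), §2.3, Prop. 2.2
  and §3. [Perutz2006]
-/

noncomputable section

open scoped Manifold ContDiff Topology
open Set Function Filter Real Module Bundle Literature.Geometry.Kaehler
  Literature.Topology.FourManifolds

namespace Literature.Geometry.Symplectic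

/-! ### The axis points -/

/-- The normal coordinates of `θ e₀` vanish. [folklore] -/
@[simp] theorem hondaAxisPoint_apply_succ (θ : ℝ) (a : Fin 3) : hondaAxisPoint θ a.succ = 0 := by
  simp [hondaAxisPoint, Fin.succ_ne_zero]

/-- `(θ + t) e₀ = θ e₀ + t e₀`. [folklore] -/
theorem hondaAxisPoint_add (θ t : ℝ) :
    hondaAxisPoint (θ + t) = hondaAxisPoint θ + t • EuclideanSpace.single 0 1 := by
  simp [hondaAxisPoint, add_smul]

/-- `θ ↦ θ e₀` is `C^∞`. [folklore] -/
theorem contDiff_hondaAxisPoint : ContDiff ℝ ∞ hondaAxisPoint := by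
  unfold hondaAxisPoint; exact contDiff_id.smul contDiff_const

/-- `θ e₀` lies in every model tube of positive radius. [folklore] -/
theorem hondaAxisPoint_mem_hondaTube {r : ℝ} (hr : 0 < r) (θ : ℝ) : hondaAxisPoint θ ∈ hondaTube r :=
  hondaAxis_subset_hondaTube hr (hondaAxisPoint_mem_hondaAxis θ)

/-- `e₀` as `stdVec 0` is `single 0 1`. [folklore] -/
theorem stdVec_zero_eq_single : (stdVec 0 : EuclideanSpace ℝ (Fin 4)) = EuclideanSpace.single 0 1 :=
  rfl

variable {M : Type*} [TopologicalSpace M] [ChartedSpace (EuclideanSpace ℝ (Fin 4)) M]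
  [IsManifold (𝓡 4) ∞ M]
  {sf : MForm (𝓡 4) M ℝ 2} {γ : ℝ → M} {χ : EuclideanSpace ℝ (Fin 4) → M} {r : ℝ}

/-! ### The tubular chart near the axis -/

omit [IsManifold (𝓡 4) ∞ M] in
/-- Smoothness of the chart near a point of the open tube. [folklore] -/
theorem eventually_contMDiffAt_of_mem_hondaTube
    (hχs : ContMDiffOn 𝓘(ℝ, EuclideanSpace ℝ (Fin 4)) (𝓡 4) ∞ χ (hondaTube r))
    {q : EuclideanSpace ℝ (Fin 4)} (hq : q ∈ hondaTube r) :
    ∀ᶠ z in 𝓝 q, ContMDiffAt 𝓘(ℝ, EuclideanSpace ℝ (Fin 4)) (𝓡 4) ∞ χ z := by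
  filter_upwards [(isOpen_hondaTube r).mem_nhds hq] with z hz
  exact (hχs z hz).contMDiffAt ((isOpen_hondaTube r).mem_nhds hz)

omit [IsManifold (𝓡 4) ∞ M] in
/-- An injective differential `ℝ⁴ → T_{χ q}M = ℝ⁴` is bijective. [folklore] -/
theorem bijective_flatDifferential_of_injective {q : EuclideanSpace ℝ (Fin 4)}
    (hinj : Injective (mfderiv 𝓘(ℝ, EuclideanSpace ℝ (Fin 4)) (𝓡 4) χ q)) :
    Bijective (flatDifferential χ q) :=
  ⟨hinj, (LinearMap.injective_iff_surjective
    (f := ((flatDifferential χ q : EuclideanSpace ℝ (Fin 4) →L[ℝ] EuclideanSpace ℝ (Fin 4)) :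
      EuclideanSpace ℝ (Fin 4) →ₗ[ℝ] EuclideanSpace ℝ (Fin 4)))).1 hinj⟩

omit [TopologicalSpace M] [ChartedSpace (EuclideanSpace ℝ (Fin 4)) M] [IsManifold (𝓡 4) ∞ M] in
/-- On the axis the chart is the curve: `χ(θ e₀) = γ(θ)`. [folklore] -/
theorem apply_hondaAxisPoint (hχγ : ∀ q ∈ hondaAxis, χ q = γ (q 0)) (θ : ℝ) :
    χ (hondaAxisPoint θ) = γ θ := by
  rw [hχγ _ (hondaAxisPoint_mem_hondaAxis θ), hondaAxisPoint_apply_zero]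

/-! ### Smoothness and periodicity of the gradient family -/

/-- **The pulled-back form is `C^∞` on the tube** as a plain function. [folklore] -/
theorem contDiffOn_pullback_hondaTube
    (hχs : ContMDiffOn 𝓘(ℝ, EuclideanSpace ℝ (Fin 4)) (𝓡 4) ∞ χ (hondaTube r))
    (hsm : IsSmoothForm sf) :
    ContDiffOn ℝ (F := (EuclideanSpace ℝ (Fin 4)) [⋀^Fin 2]→L[ℝ] ℝ) ∞
      (fun y ↦ sf.pullback 𝓘(ℝ, EuclideanSpace ℝ (Fin 4)) χ y) (hondaTube r) :=
  fun _ hq ↦ (contDiffAt_pullback_of_mem_hondaTube hχs (fun q _ ↦ hsm (χ q)) hq).contDiffWithinAt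

/-- **`θ ↦ J(θ) W` is `C^∞`**, `J(θ)` the gradient of `χ^*sf` at `θ e₀`. [cite: Perutz2006, §3 (proof of Lemma 3.1, step 1)] -/
theorem contDiff_zeroGradient_pullback_axis (hr : 0 < r)
    (hχs : ContMDiffOn 𝓘(ℝ, EuclideanSpace ℝ (Fin 4)) (𝓡 4) ∞ χ (hondaTube r))
    (hsm : IsSmoothForm sf) (W : EuclideanSpace ℝ (Fin 4)) :
    ContDiff ℝ ∞ fun θ ↦
      zeroGradient (sf.pullback 𝓘(ℝ, EuclideanSpace ℝ (Fin 4)) χ) (hondaAxisPoint θ) W := by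
  set G : EuclideanSpace ℝ (Fin 4) → (EuclideanSpace ℝ (Fin 4)) [⋀^Fin 2]→L[ℝ] ℝ :=
    fun y ↦ sf.pullback 𝓘(ℝ, EuclideanSpace ℝ (Fin 4)) χ y with hG
  have hGs : ContDiffOn ℝ ∞ G (hondaTube r) := contDiffOn_pullback_hondaTube hχs hsm
  have hfd : ContDiffOn ℝ ∞ (fderiv ℝ G) (hondaTube r) :=
    hGs.fderiv_of_isOpen (isOpen_hondaTube r) (by simp)
  have h1 : ContDiff ℝ ∞ fun θ ↦ fderiv ℝ G (hondaAxisPoint θ) :=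
    contDiff_iff_contDiffAt.2 fun θ ↦ (hfd.contDiffAt
      ((isOpen_hondaTube r).mem_nhds (hondaAxisPoint_mem_hondaTube hr θ))).comp θ
        contDiff_hondaAxisPoint.contDiffAt
  have h2 : (fun θ ↦ zeroGradient (sf.pullback 𝓘(ℝ, EuclideanSpace ℝ (Fin 4)) χ)
      (hondaAxisPoint θ) W) = fun θ ↦ fderiv ℝ G (hondaAxisPoint θ) W := by
    funext θ; rw [zeroGradient_eq_fderiv_model]
  rw [h2]
  exact (ContinuousLinearMap.apply ℝ _ W).contDiff.comp h1

omit [IsManifold (𝓡 4) ∞ M] in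
/-- **`J(θ + 2π) = J(θ)`** for a `2π`-periodic chart. [folklore] -/
theorem zeroGradient_pullback_axis_periodic (hr : 0 < r)
    (hχs : ContMDiffOn 𝓘(ℝ, EuclideanSpace ℝ (Fin 4)) (𝓡 4) ∞ χ (hondaTube r))
    (hχper : ∀ q, χ (q + (2 * π) • EuclideanSpace.single (0 : Fin 4) (1 : ℝ)) = χ q) (θ : ℝ) :
    zeroGradient (sf.pullback 𝓘(ℝ, EuclideanSpace ℝ (Fin 4)) χ) (hondaAxisPoint (θ + 2 * π)) =
      zeroGradient (sf.pullback 𝓘(ℝ, EuclideanSpace ℝ (Fin 4)) χ) (hondaAxisPoint θ) := by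
  set p₀ : EuclideanSpace ℝ (Fin 4) := (2 * π) • EuclideanSpace.single (0 : Fin 4) (1 : ℝ)
    with hp₀
  set G : EuclideanSpace ℝ (Fin 4) → (EuclideanSpace ℝ (Fin 4)) [⋀^Fin 2]→L[ℝ] ℝ :=
    fun y ↦ sf.pullback 𝓘(ℝ, EuclideanSpace ℝ (Fin 4)) χ y with hG
  rw [zeroGradient_eq_fderiv_model, zeroGradient_eq_fderiv_model, hondaAxisPoint_add]
  change fderiv ℝ G (hondaAxisPoint θ + p₀) = fderiv ℝ G (hondaAxisPoint θ)
  -- `G (y + p₀) = G y` near the axis point (differentiability of `χ` on the tube)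
  have hloc : (fun y ↦ G (y + p₀)) =ᶠ[𝓝 (hondaAxisPoint θ)] G := by
    filter_upwards [(isOpen_hondaTube r).mem_nhds (hondaAxisPoint_mem_hondaTube hr θ)] with y hy
    have hy' : y + p₀ ∈ hondaTube r := by
      simpa [mem_hondaTube, hp₀] using (mem_hondaTube.1 hy)
    have hd : MDifferentiableAt 𝓘(ℝ, EuclideanSpace ℝ (Fin 4)) (𝓡 4) χ (y + p₀) :=
      ((hχs _ hy').contMDiffAt ((isOpen_hondaTube r).mem_nhds hy')).mdifferentiableAt (by simp)
    change sf.pullback 𝓘(ℝ, EuclideanSpace ℝ (Fin 4)) χ (y + p₀) =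
      sf.pullback 𝓘(ℝ, EuclideanSpace ℝ (Fin 4)) χ y
    ext v
    exact pullback_apply_add_eq_of_forall hχper hd v
  rw [← fderiv_comp_add_right p₀, hloc.fderiv_eq]

/-! ### The axis direction lies in the kernel; symmetry of Perutz's form -/

omit [IsManifold (𝓡 4) ∞ M] in
/-- The pulled-back form vanishes on the axis. [folklore] -/
theorem pullback_hondaAxisPoint_eq_zero (hχγ : ∀ q ∈ hondaAxis, χ q = γ (q 0))
    (hZ : ∀ θ, sf (γ θ) = 0) (θ : ℝ) :
    sf.pullback 𝓘(ℝ, EuclideanSpace ℝ (Fin 4)) χ (hondaAxisPoint θ) = 0 :=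
  pullback_apply_eq_zero (by rw [apply_hondaAxisPoint hχγ]; exact hZ θ)

/-- **`J(θ) e₀ = 0`**: the gradient kills the axis direction. [cite: Perutz2006, proof of Lemma 1.2] -/
theorem zeroGradient_pullback_axis_stdVec_zero (hr : 0 < r)
    (hχs : ContMDiffOn 𝓘(ℝ, EuclideanSpace ℝ (Fin 4)) (𝓡 4) ∞ χ (hondaTube r))
    (hsm : IsSmoothForm sf) (hχγ : ∀ q ∈ hondaAxis, χ q = γ (q 0)) (hZ : ∀ θ, sf (γ θ) = 0)
    (θ : ℝ) :
    zeroGradient (sf.pullback 𝓘(ℝ, EuclideanSpace ℝ (Fin 4)) χ) (hondaAxisPoint θ) (stdVec 0) = 0 := by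
  rw [zeroGradient_eq_fderiv_model, stdVec_zero_eq_single]
  refine fderiv_apply_eq_zero_of_forall_line ?_ fun t ↦ ?_
  · exact ((contDiffOn_pullback_hondaTube hχs hsm).contDiffAt
      ((isOpen_hondaTube r).mem_nhds (hondaAxisPoint_mem_hondaTube hr θ))).differentiableAt
      (by simp)
  · rw [← hondaAxisPoint_add]
    exact pullback_hondaAxisPoint_eq_zero hχγ hZ (θ + t)

/-- **Symmetry of Perutz's form of the pulled-back form**: `J(θ)(p)(e₀, q) = J(θ)(q)(e₀, p)`
(closedness of `sf`, naturality of `d`, `zeroNormalForm_symm`). [cite: Perutz2006, §2.3 (c)] -/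
theorem zeroGradient_pullback_axis_symm (hr : 0 < r)
    (hχs : ContMDiffOn 𝓘(ℝ, EuclideanSpace ℝ (Fin 4)) (𝓡 4) ∞ χ (hondaTube r))
    (hsm : IsSmoothForm sf) (hcl : IsClosedForm sf) (hχγ : ∀ q ∈ hondaAxis, χ q = γ (q 0))
    (hZ : ∀ θ, sf (γ θ) = 0) (θ : ℝ) (p q : EuclideanSpace ℝ (Fin 4)) :
    zeroGradient (sf.pullback 𝓘(ℝ, EuclideanSpace ℝ (Fin 4)) χ) (hondaAxisPoint θ) p ![stdVec 0, q] =
      zeroGradient (sf.pullback 𝓘(ℝ, EuclideanSpace ℝ (Fin 4)) χ) (hondaAxisPoint θ) q ![stdVec 0, p] := by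
  have hd : mextDeriv (sf.pullback 𝓘(ℝ, EuclideanSpace ℝ (Fin 4)) χ) (hondaAxisPoint θ) = 0 := by
    rw [mextDeriv_pullback_apply (eventually_contMDiffAt_of_mem_hondaTube hχs
      (hondaAxisPoint_mem_hondaTube hr θ)) (hsm _), show mextDeriv sf = 0 from hcl]
    rfl
  exact zeroNormalForm_symm hd (zeroGradient_pullback_axis_stdVec_zero hr hχs hsm hχγ hZ θ) p q

/-! ### Rank and the constant definite sign -/

/-- **Rank `3` along the axis** (transport of transverse zeros). [cite: Perutz2006, Def. 1.1] -/
theorem finrank_range_zeroGradient_pullback_axis (hr : 0 < r)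
    (hχs : ContMDiffOn 𝓘(ℝ, EuclideanSpace ℝ (Fin 4)) (𝓡 4) ∞ χ (hondaTube r))
    (hχinj : ∀ q ∈ hondaTube r, Injective (mfderiv 𝓘(ℝ, EuclideanSpace ℝ (Fin 4)) (𝓡 4) χ q))
    (hsm : IsSmoothForm sf) (hχγ : ∀ q ∈ hondaAxis, χ q = γ (q 0))
    (hT : ∀ θ, IsTransverseZero sf (γ θ)) (θ : ℝ) :
    Module.finrank ℝ (LinearMap.range (zeroGradient (sf.pullback 𝓘(ℝ, EuclideanSpace ℝ (Fin 4)) χ)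
      (hondaAxisPoint θ)).toLinearMap) = 3 := by
  have hq := hondaAxisPoint_mem_hondaTube hr θ
  have h : IsTransverseZero sf (χ (hondaAxisPoint θ)) := by
    rw [apply_hondaAxisPoint hχγ]; exact hT θ
  exact (h.pullback (eventually_contMDiffAt_of_mem_hondaTube hχs hq) (hsm _)
    (bijective_flatDifferential_of_injective (hχinj _ hq))).2

/-- `e₁` is off the kernel `ℝ e₀` of a rank-`3` gradient killing `e₀`. [folklore] -/
theorem zeroGradient_pullback_axis_stdVec_one_ne_zero
    {J : EuclideanSpace ℝ (Fin 4) →L[ℝ] ((EuclideanSpace ℝ (Fin 4)) [⋀^Fin 2]→L[ℝ] ℝ)}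
    (hrank : Module.finrank ℝ (LinearMap.range J.toLinearMap) = 3) (hJ0 : J (stdVec 0) = 0) :
    J (stdVec 1) ≠ 0 := by
  intro h1
  have he0 : (stdVec 0 : EuclideanSpace ℝ (Fin 4)) ≠ 0 := by
    intro h; have := congrArg (· 0) h; simp [stdVec] at this
  have hker1 : Module.finrank ℝ (LinearMap.ker J.toLinearMap) = 1 := by
    have hrn := LinearMap.finrank_range_add_finrank_ker J.toLinearMap
    rw [hrank, finrank_euclideanSpace_fin] at hrn
    omega
  have hτk : (⟨stdVec 0, LinearMap.mem_ker.2 hJ0⟩ : LinearMap.ker J.toLinearMap) ≠ 0 :=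
    fun h0 ↦ he0 (congrArg Subtype.val h0)
  obtain ⟨b, hb⟩ := (finrank_eq_one_iff_of_nonzero' _ hτk).1 hker1
    ⟨stdVec 1, LinearMap.mem_ker.2 h1⟩
  have h := congrArg (fun v : LinearMap.ker J.toLinearMap ↦ (v : EuclideanSpace ℝ (Fin 4)) 1) hb
  simp [stdVec] at h

/-- **A constant definite sign of the image along the axis.**  If `sf` has positive zeros along
`γ` (for an orientation `o`), then there is ONE `s = ±1` with `s Pf(J(θ) W) > 0` for all `θ`
and all `W` with `J(θ) W ≠ 0`: pointwise the sign is that of `o` times `det dχ` (transport,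
`definite_zeroGradient_pullback`), and it cannot change with `θ` because `θ ↦ Pf(J(θ) e₁)` is
continuous and never zero. [cite: Perutz2006, Lemma 2.1 (b)] -/
theorem exists_sign_zeroGradient_pullback_axis (o : SmoothOrientation (𝓡 4) M) (hr : 0 < r)
    (hχs : ContMDiffOn 𝓘(ℝ, EuclideanSpace ℝ (Fin 4)) (𝓡 4) ∞ χ (hondaTube r))
    (hχinj : ∀ q ∈ hondaTube r, Injective (mfderiv 𝓘(ℝ, EuclideanSpace ℝ (Fin 4)) (𝓡 4) χ q))
    (hsm : IsSmoothForm sf) (hχγ : ∀ q ∈ hondaAxis, χ q = γ (q 0))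
    (hpos : ∀ θ, IsPositiveZero o sf (γ θ)) :
    ∃ s : ℝ, (s = 1 ∨ s = -1) ∧ ∀ θ W,
      zeroGradient (sf.pullback 𝓘(ℝ, EuclideanSpace ℝ (Fin 4)) χ) (hondaAxisPoint θ) W ≠ 0 →
        0 < s * pfaffian (zeroGradient (sf.pullback 𝓘(ℝ, EuclideanSpace ℝ (Fin 4)) χ)
          (hondaAxisPoint θ) W) := by
  set J := fun θ ↦ zeroGradient (sf.pullback 𝓘(ℝ, EuclideanSpace ℝ (Fin 4)) χ) (hondaAxisPoint θ)
    with hJ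
  -- pointwise: some sign `s₁ θ = ±1`
  have hpt : ∀ θ, ∃ s₁ : ℝ, (s₁ = 1 ∨ s₁ = -1) ∧ ∀ W, J θ W ≠ 0 → 0 < s₁ * pfaffian (J θ W) := by
    intro θ
    have hq := hondaAxisPoint_mem_hondaTube hr θ
    have hposθ : IsPositiveZero o sf (χ (hondaAxisPoint θ)) := by
      rw [apply_hondaAxisPoint hχγ]; exact hpos θ
    obtain ⟨s₀, hs₀, hdef₀⟩ := hposθ.exists_sign
    have hL := bijective_flatDifferential_of_injective (hχinj _ hq)
    refine ⟨if 0 < LinearMap.det ((flatDifferential χ (hondaAxisPoint θ) :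
        EuclideanSpace ℝ (Fin 4) →L[ℝ] EuclideanSpace ℝ (Fin 4)) :
          EuclideanSpace ℝ (Fin 4) →ₗ[ℝ] EuclideanSpace ℝ (Fin 4)) then s₀ else -s₀, ?_, fun W hW ↦ ?_⟩
    · split_ifs
      · exact hs₀
      · rcases hs₀ with rfl | rfl <;> simp
    · exact definite_zeroGradient_pullback (eventually_contMDiffAt_of_mem_hondaTube hχs hq) (hsm _)
        hposθ.mem_zeroLocus hL hdef₀ W hW
  choose s₁ hs₁ hdef₁ using hpt
  -- the reference function `θ ↦ Pf(J θ e₁)`: continuous, never zero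
  have hT : ∀ θ, IsTransverseZero sf (γ θ) := fun θ ↦ (hpos θ).isTransverseZero
  have hZ : ∀ θ, sf (γ θ) = 0 := fun θ ↦ (hpos θ).mem_zeroLocus
  have hne : ∀ θ, J θ (stdVec 1) ≠ 0 := fun θ ↦
    zeroGradient_pullback_axis_stdVec_one_ne_zero
      (finrank_range_zeroGradient_pullback_axis hr hχs hχinj hsm hχγ hT θ)
      (zeroGradient_pullback_axis_stdVec_zero hr hχs hsm hχγ hZ θ)
  set q : ℝ → ℝ := fun θ ↦ pfaffian (J θ (stdVec 1)) with hq
  have hqc : Continuous q :=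
    contDiff_pfaffian.continuous.comp (contDiff_zeroGradient_pullback_axis hr hχs hsm _).continuous
  have hq0 : ∀ θ, q θ ≠ 0 := fun θ h0 ↦ by
    have := hdef₁ θ (stdVec 1) (hne θ)
    rw [show pfaffian (J θ (stdVec 1)) = q θ from rfl, h0, mul_zero] at this
    exact lt_irrefl _ this
  -- the sign of `q` is constant (connectedness of `ℝ`)
  have hsign : ∃ s : ℝ, (s = 1 ∨ s = -1) ∧ ∀ θ, 0 < s * q θ := by
    by_cases h0 : 0 < q 0
    · refine ⟨1, Or.inl rfl, fun θ ↦ ?_⟩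
      rw [one_mul]
      by_contra hθ
      have hθ' : q θ < 0 := lt_of_le_of_ne (not_lt.1 hθ) (hq0 θ)
      obtain ⟨ξ, hξ⟩ := intermediate_value_univ θ 0 hqc ⟨hθ'.le, h0.le⟩
      exact hq0 ξ hξ
    · have h0' : q 0 < 0 := lt_of_le_of_ne (not_lt.1 h0) (hq0 0)
      refine ⟨-1, Or.inr rfl, fun θ ↦ ?_⟩
      rw [neg_one_mul, neg_pos]
      by_contra hθ
      have hθ' : 0 < q θ := lt_of_le_of_ne (not_lt.1 hθ) (hq0 θ).symm
      obtain ⟨ξ, hξ⟩ := intermediate_value_univ 0 θ hqc ⟨h0'.le, hθ'.le⟩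
      exact hq0 ξ hξ
  obtain ⟨s, hs, hsq⟩ := hsign
  refine ⟨s, hs, fun θ W hW ↦ ?_⟩
  -- at `θ`, `s₁ θ` and `s` agree (both make `Pf(J θ e₁)` positive)
  have h1 := hdef₁ θ (stdVec 1) (hne θ)
  have h2 := hsq θ
  change 0 < s * q θ at h2
  change 0 < s₁ θ * q θ at h1
  have heq : s₁ θ = s := by
    rcases hs₁ θ with h | h <;> rcases hs with h' | h'
    · rw [h, h']
    · rw [h] at h1; rw [h'] at h2; nlinarith
    · rw [h] at h1; rw [h'] at h2; nlinarith
    · rw [h, h']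
  rw [← heq]
  exact hdef₁ θ W hW

/-! ### The continuous periodic minority seed -/

omit [IsManifold (𝓡 4) ∞ M] in
/-- Perutz's form `(v, u) ↦ J v (e₀, u)` is unchanged when multiples of `e₀` are added to the
argument `v`, if `J e₀ = 0`; hence so is the minority property. [cite: Perutz2006, §2.3 (d)] -/
theorem isMinorityVector_add_smul_stdVec_zero_iff
    {J : EuclideanSpace ℝ (Fin 4) →L[ℝ] ((EuclideanSpace ℝ (Fin 4)) [⋀^Fin 2]→L[ℝ] ℝ)}
    (hJ0 : J (stdVec 0) = 0) (v : EuclideanSpace ℝ (Fin 4)) (t : ℝ) :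
    IsMinorityVector (fun a b ↦ J a ![stdVec 0, b]) (v + t • stdVec 0) ↔
      IsMinorityVector (fun a b ↦ J a ![stdVec 0, b]) v := by
  have h1 : ∀ b, J (v + t • stdVec 0) ![stdVec 0, b] = J v ![stdVec 0, b] := fun b ↦ by
    rw [map_add, map_smul, hJ0, smul_zero, add_zero]
  have h2 : ∀ a : EuclideanSpace ℝ (Fin 4), J a ![stdVec 0, v + t • stdVec 0] = J a ![stdVec 0, v] := by
    intro a
    have hupd : (![stdVec 0, v + t • stdVec 0] : Fin 2 → EuclideanSpace ℝ (Fin 4)) =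
        Function.update ![stdVec 0, v] 1 (v + t • stdVec 0) := by
      funext i; fin_cases i <;> simp
    have hupd' : (![stdVec 0, stdVec 0] : Fin 2 → EuclideanSpace ℝ (Fin 4)) =
        Function.update ![stdVec 0, v] 1 (stdVec 0) := by
      funext i; fin_cases i <;> simp
    have hzero : J a ![stdVec 0, stdVec 0] = 0 :=
      (J a).map_eq_zero_of_eq ![stdVec 0, stdVec 0] (i := 0) (j := 1) rfl (by decide)
    rw [hupd, (J a).map_update_add, (J a).map_update_smul, ← hupd', hzero, smul_zero, add_zero,
      ← show (![stdVec 0, v] : Fin 2 → EuclideanSpace ℝ (Fin 4)) =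
        Function.update ![stdVec 0, v] 1 v from by funext i; fin_cases i <;> simp]
  simp only [IsMinorityVector, h1, h2]

/-- The velocity section `θ ↦ (γ θ, γ'(θ))` of a `C¹` curve is continuous in `TM` (Mathlib's
`ContMDiff.continuous_tangentMap` on the constant section `1` of `Tℝ`). [folklore] -/
theorem continuous_zeroCircleTangent_section {c : ℝ → M} (hc : ContMDiff 𝓘(ℝ, ℝ) (𝓡 4) 1 c) :
    Continuous fun t ↦ (TotalSpace.mk' (EuclideanSpace ℝ (Fin 4)) (c t) (zeroCircleTangent c t) :
      TangentBundle (𝓡 4) M) := by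
  have h1 := hc.continuous_tangentMap le_rfl
  have h2 : Continuous (fun t : ℝ ↦ (TotalSpace.mk' ℝ t (1 : ℝ) : TangentBundle 𝓘(ℝ, ℝ) ℝ)) := by
    have : Continuous ((tangentBundleModelSpaceHomeomorph 𝓘(ℝ, ℝ)).symm ∘
        fun t : ℝ ↦ (t, (1 : ℝ))) := (Homeomorph.continuous _).comp (by fun_prop)
    exact this
  exact h1.comp h2

omit [IsManifold (𝓡 4) ∞ M] in
/-- The frame `dχ(eᵢ)` along the axis is linearly independent (immersion). [folklore] -/
theorem linearIndependent_mfderiv_stdVec {q : EuclideanSpace ℝ (Fin 4)}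
    (hinj : Injective (mfderiv 𝓘(ℝ, EuclideanSpace ℝ (Fin 4)) (𝓡 4) χ q)) :
    LinearIndependent ℝ fun i : Fin 4 ↦
      (mfderiv 𝓘(ℝ, EuclideanSpace ℝ (Fin 4)) (𝓡 4) χ q (stdVec i) : EuclideanSpace ℝ (Fin 4)) := by
  have hb : LinearIndependent ℝ (stdVec : Fin 4 → EuclideanSpace ℝ (Fin 4)) := by
    refine Fintype.linearIndependent_iff.2 fun g hg j ↦ ?_
    have := congrArg (fun W : EuclideanSpace ℝ (Fin 4) ↦ W j) hg
    fin_cases j <;> simpa [stdVec, Finset.sum_apply, Fin.sum_univ_four] using this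
  have := hb.map' ((flatDifferential χ q : EuclideanSpace ℝ (Fin 4) →L[ℝ] EuclideanSpace ℝ (Fin 4)) :
    EuclideanSpace ℝ (Fin 4) →ₗ[ℝ] EuclideanSpace ℝ (Fin 4)) (LinearMap.ker_eq_bot.2 hinj)
  exact this

/-- **A continuous `2π`-periodic minority seed for the pulled-back form.**  From the even-circle
section `V` (a continuous periodic family of minority vectors of `S_{γ(θ), γ'(θ)}`) and the frame
`dχ(e₀) = γ'`, `dχ(e_{a+1}) = ν_a` along the axis, the normal part `w(θ) = Σ_a c_{a+1}(θ) e_{a+1}`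
of `dχ⁻¹ V(θ) = Σ cᵢ(θ) eᵢ` is a continuous periodic family of minority vectors of Perutz's form
`(v, u) ↦ J(θ) v (e₀, u)` of `χ^*sf` (transport `isMinorityVector_pullback_iff`; the `e₀`-component
is irrelevant as `J(θ) e₀ = 0`). [cite: Perutz2006, Prop. 2.2 and §2.3 (d)] -/
theorem exists_continuous_minority_seed (hr : 0 < r)
    (hχs : ContMDiffOn 𝓘(ℝ, EuclideanSpace ℝ (Fin 4)) (𝓡 4) ∞ χ (hondaTube r))
    (hχper : ∀ q, χ (q + (2 * π) • EuclideanSpace.single (0 : Fin 4) (1 : ℝ)) = χ q)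
    (hχinj : ∀ q ∈ hondaTube r, Injective (mfderiv 𝓘(ℝ, EuclideanSpace ℝ (Fin 4)) (𝓡 4) χ q))
    (hsm : IsSmoothForm sf) (hχγ : ∀ q ∈ hondaAxis, χ q = γ (q 0)) (hZ : ∀ θ, sf (γ θ) = 0)
    (hγ : ContMDiff 𝓘(ℝ, ℝ) (𝓡 4) ∞ γ)
    {ν : Fin 3 → ℝ → EuclideanSpace ℝ (Fin 4)}
    (hνc : ∀ a, Continuous fun θ ↦
      (TotalSpace.mk' (EuclideanSpace ℝ (Fin 4)) (γ θ) (ν a θ) : TangentBundle (𝓡 4) M))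
    (hdχ0 : ∀ θ, mfderiv 𝓘(ℝ, EuclideanSpace ℝ (Fin 4)) (𝓡 4) χ (hondaAxisPoint θ) (stdVec 0) =
      zeroCircleTangent γ θ)
    (hdχsucc : ∀ θ (a : Fin 3),
      mfderiv 𝓘(ℝ, EuclideanSpace ℝ (Fin 4)) (𝓡 4) χ (hondaAxisPoint θ) (stdVec a.succ) = ν a θ)
    {V : ℝ → EuclideanSpace ℝ (Fin 4)} (hVper : ∀ θ, V (θ + 2 * π) = V θ)
    (hVc : Continuous fun θ ↦
      (TotalSpace.mk' (EuclideanSpace ℝ (Fin 4)) (γ θ) (V θ) : TangentBundle (𝓡 4) M))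
    (hVmin : ∀ θ, IsMinorityVector (zeroNormalForm sf (γ θ) (zeroCircleTangent γ θ)) (V θ)) :
    ∃ w : ℝ → EuclideanSpace ℝ (Fin 4), Continuous w ∧ (∀ θ, w θ 0 = 0) ∧
      (∀ θ, w (θ + 2 * π) = w θ) ∧
      ∀ θ, IsMinorityVector (fun v u ↦ zeroGradient (sf.pullback 𝓘(ℝ, EuclideanSpace ℝ (Fin 4)) χ)
        (hondaAxisPoint θ) v ![stdVec 0, u]) (w θ) := by
  -- the frame `f θ i = dχ_{θ e₀}(eᵢ)` : continuous in `TM`, independent, periodic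
  set f : ℝ → Fin 4 → EuclideanSpace ℝ (Fin 4) := fun θ i ↦
    mfderiv 𝓘(ℝ, EuclideanSpace ℝ (Fin 4)) (𝓡 4) χ (hondaAxisPoint θ) (stdVec i) with hf
  have hfc : ∀ i, Continuous fun θ ↦
      (TotalSpace.mk' (EuclideanSpace ℝ (Fin 4)) (γ θ) (f θ i) : TangentBundle (𝓡 4) M) := by
    intro i
    induction i using Fin.cases with
    | zero =>
      simp only [hf, hdχ0]
      exact continuous_zeroCircleTangent_section (hγ.of_le (by simp))
    | succ a =>
      simp only [hf, hdχsucc]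
      exact hνc a
  have hfli : ∀ θ, LinearIndependent ℝ (f θ) := fun θ ↦
    linearIndependent_mfderiv_stdVec (hχinj _ (hondaAxisPoint_mem_hondaTube hr θ))
  obtain ⟨c, hcc, hcV⟩ := continuous_frameCoefficients hfc hVc hfli
  -- periodicity of the frame and of the coefficients
  set p₀ : EuclideanSpace ℝ (Fin 4) := (2 * π) • EuclideanSpace.single (0 : Fin 4) (1 : ℝ) with hp₀
  have hfper : ∀ θ, f (θ + 2 * π) = f θ := by
    intro θ
    funext i
    simp only [hf]
    have hq' : hondaAxisPoint θ + p₀ ∈ hondaTube r := by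
      rw [hp₀, ← hondaAxisPoint_add]; exact hondaAxisPoint_mem_hondaTube hr _
    have hd : MDifferentiableAt 𝓘(ℝ, EuclideanSpace ℝ (Fin 4)) (𝓡 4) χ (hondaAxisPoint θ + p₀) :=
      ((hχs _ hq').contMDiffAt ((isOpen_hondaTube r).mem_nhds hq')).mdifferentiableAt (by simp)
    have key := mfderiv_eq_mfderiv_add_of_forall hχper hd
    rw [hondaAxisPoint_add, ← hp₀]
    exact (congrArg (fun L : EuclideanSpace ℝ (Fin 4) →L[ℝ] EuclideanSpace ℝ (Fin 4) ↦ L (stdVec i))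
      key).symm
  have hcper : ∀ θ, c (θ + 2 * π) = c θ := by
    intro θ
    have h1 := hcV (θ + 2 * π)
    rw [hVper, hfper, hcV θ] at h1
    have h2 : ∑ i, (c (θ + 2 * π) i - c θ i) • f θ i = 0 := by
      simp only [sub_smul, Finset.sum_sub_distrib]
      rw [← h1, sub_self]
    funext i
    have := Fintype.linearIndependent_iff.1 (hfli θ) _ h2 i
    linarith
  -- the seed: the normal part of `dχ⁻¹ V`
  refine ⟨fun θ ↦ normalLift fun a ↦ c θ a.succ, ?_, fun θ ↦ normalLift_apply_zero _, fun θ ↦ ?_,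
    fun θ ↦ ?_⟩
  · unfold normalLift
    exact continuous_finsetSum _ fun a _ ↦
      ((continuous_apply a.succ).comp hcc).smul continuous_const
  · simp only [hcper]
  · -- transport of the minority property
    have hq := hondaAxisPoint_mem_hondaTube hr θ
    have h0 : sf (χ (hondaAxisPoint θ)) = 0 := by rw [apply_hondaAxisPoint hχγ]; exact hZ θ
    have hL := bijective_flatDifferential_of_injective (hχinj _ hq)
    set v : EuclideanSpace ℝ (Fin 4) := normalLift (fun a ↦ c θ a.succ) + c θ 0 • stdVec 0 with hv
    have hvsum : v = ∑ i, c θ i • stdVec i := by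
      rw [hv, Fin.sum_univ_succ, add_comm]; rfl
    have hdv : flatDifferential χ (hondaAxisPoint θ) v = V θ := by
      rw [hvsum, map_sum, hcV θ]
      refine Finset.sum_congr rfl fun i _ ↦ ?_
      rw [map_smul]; rfl
    have hdτ : flatDifferential χ (hondaAxisPoint θ) (stdVec 0) = zeroCircleTangent γ θ := hdχ0 θ
    have hmin : IsMinorityVector (zeroNormalForm (sf.pullback 𝓘(ℝ, EuclideanSpace ℝ (Fin 4)) χ)
        (hondaAxisPoint θ) (stdVec 0)) v := by
      rw [isMinorityVector_pullback_iff (eventually_contMDiffAt_of_mem_hondaTube hχs hq) (hsm _) h0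
        hL.2, hdv, hdτ, apply_hondaAxisPoint hχγ]
      exact hVmin θ
    have hJ0 := zeroGradient_pullback_axis_stdVec_zero hr hχs hsm hχγ hZ θ
    have hmin' : IsMinorityVector (fun a b ↦ zeroGradient
        (sf.pullback 𝓘(ℝ, EuclideanSpace ℝ (Fin 4)) χ) (hondaAxisPoint θ) a ![stdVec 0, b]) v := hmin
    rw [hv, isMinorityVector_add_smul_stdVec_zero_iff hJ0] at hmin'
    exact hmin'

end Literature.Geometry.Symplectic

end
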